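import Summits.Ventures.HSemireg.UntwistCocycleTwistDualHom
import HarnessLib

/-!
# Venture HSemireg — route R1.0, untwisted reading: the trace with coefficients along the comparison
# `λ_G : (𝓗om(E^∨, G)) ⊗ M ⟶ 𝓗om((E ⊗ M)^∨, G)` (gs-g4; sequel of `UntwistCocycleTwistDualHom.lean`)

HONEST FRAMING. Module-level homological algebra on the tree's REAL carriers (Mathlib's `Abelian.Ext` in
`X.Modules`, the contraction `Modules.contract`, the trace with coefficients `HodgeTheory.traceExtCoeff`, the cocycle
twist `- ⊗ M` of th-4's files #11–#17 and the comparison `λ_G = CocycleTwist.dualHomTwist`). Nothing about any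
variety; no gerbe; nothing here says HC, HC_CM or HC_AV is proved.

* `sheafHomTwist_dualHomTwist_contract` — **`γ ≫ 𝓗om(E⟨c⟩, λ_G) ≫ c^{E⟨c⟩}_G = c^E_G`**: the comparison
  intertwines the contractions `𝓗om(E, 𝓗om(E^∨, G)) → G` of `E` and of `E⟨c⟩` (in a frame `b_i` of `E` over
  `W ⊆ U_z` and the frame `b_i ⊗ t_z` of `E⟨c⟩` both are `Σ_i B(b_i)(b_i^*)`; th-4's `hom_ext_of_frames_le`);
* `mk₀_comp_mapExactFunctor_comp_mk₀_eq''` — th-4's two-object sandwich identity (#17 v1.1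
  `mk₀_comp_mapExactFunctor_comp_mk₀_eq'`) with a comparison leg inserted;
* `traceExtCoeff_twist_comp_dualHomTwist` — **`Tr^{E⟨c⟩}_G(θ(y) · [λ_G]) = Tr^E_G(y)`** in `Extⁿ(𝒪_X, G)` for
  every `y ∈ Extⁿ(E, 𝓗om(E^∨, G))`, `E` finite locally free, `θ = - ⊗ M` on `Ext`: the `E⟨c⟩`-side trace with
  coefficients of a twisted class read through `λ_G` is the `E`-side trace. With `G = Ω^q` and
  `y = x · ι · At(E)^q` this is the term `σ_q^E(x)` of the row `q` of the Leibniz re-expansion `hσ`.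

Which Ext groups: `Extⁿ(E, 𝓗om(E^∨, G))`, `Extⁿ(E⟨c⟩, 𝓗om((E⟨c⟩)^∨, G))`, `Extⁿ(𝒪_X, G)`; which class: any;
which twist: `- ⊗ M_B`, `M_B = lineBundle c`.

## References

* R.-O. Buchweitz, H. Flenner, *A semiregularity map for modules and applications to deformations*, Compositio
  Math. 137 (2003), §4 (trace maps `Tr : Ext^k(F, F ⊗ G) → H^k(X, G)`). [BuchweitzFlenner2003]
* R. Hartshorne, *Algebraic Geometry*, GTM 52 (1977), II Ex. 5.1 (a), (b), III.6.7. [Hartshorne1977]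
-/

noncomputable section

open CategoryTheory CategoryTheory.Abelian AlgebraicGeometry Opposite TopologicalSpace

namespace Summit.Ventures.HSemireg

namespace CocycleTwist

open Literature.AlgebraicGeometry.Modules Literature.AlgebraicGeometry.Motives
  Literature.AlgebraicGeometry.HodgeTheory

universe u

variable {X : Scheme.{u}} (c : UnitCocycle X) {E G : X.Modules}

/-! ### `λ_G` intertwines the contractions of `E` and of `E⟨c⟩` -/

section Contract

variable (E G) (hE : IsFiniteLocallyFree E)

/-- `t_z ≫ t_z⁻¹ = 𝟙` on sections: `(e ⊗ t_z)_z = e`. [folklore] -/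
theorem toTwistOver_comp_ofTwistOver (z : X) (W : X.Opens) (hW : W ≤ c.U z) :
    toTwistOver c E z W hW ≫ ofTwistOver c E z W hW = 𝟙 (E.over W) :=
  (twistTrivOver c E z W hW).hom_inv_id

/-- **`γ ≫ 𝓗om(E⟨c⟩, λ_G) ≫ c^{E⟨c⟩}_G = c^E_G`**: for `B : E| → 𝓗om(E^∨, G)|` over a framed open
`W ⊆ U_z`, the contraction of `B⟨c⟩ ≫ λ_G` in the frame `b_i ⊗ t_z` (dual frame `t_z^{-1} ≫ b_i^*`) is
`Σ_i B(b_i)(b_i^*)`, the contraction of `B` (`B⟨c⟩(b_i ⊗ t_z) = B(b_i) ⊗ t_z`, `λ_G` over `U_z` evaluates the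
`z`-component on `t_z ≫ t_z⁻¹ ≫ b_i^* = b_i^*`). [cite: BuchweitzFlenner2003, §4 (trace map); Hartshorne1977, II Ex. 5.1 (b)] -/
theorem sheafHomTwist_dualHomTwist_contract :
    sheafHomTwist c E (sheafHom (dual E) G) ≫ sheafHomMap (twist c E) (dualHomTwist c E G) ≫
        contract (isFiniteLocallyFree_twist c hE) G =
      contract hE G := by
  refine hom_ext_of_frames_le c E hE fun W I _ f z hW (B : E.over W ⟶ (sheafHom (dual E) G).over W) => ?_
  change (contract (isFiniteLocallyFree_twist c hE) G).app W
      (twistMapOver c B ≫ (SheafOfModules.overFunctor _ W).map (dualHomTwist c E G)) =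
    (contract hE G).app W B
  rw [contract_app_eq_frameContract hE G f,
    contract_app_eq_frameContract (isFiniteLocallyFree_twist c hE) G (f ≪≫ twistTrivOver c E z W hW),
    frameContract, frameContract]
  refine Finset.sum_congr rfl fun i _ => ?_
  rw [basisSection_trans_over, dualBasis_trans_over, appLE_comp, appLE_over_map]
  change appLE ((dualHomTwist c E G).app W (appLE (twistMapOver c B) (𝟙 W)
      (appLE (toTwistOver c E z W hW) (𝟙 W) (basisSection f i)))) (𝟙 W)
      ((ofTwistOver c E z W hW ≫ dualBasis f i : Γ(dual (twist c E), W))) = _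
  rw [appLE_toTwistOver, appLE_twistMapOver_trivSection, appLE_dualHomTwist c E G z _ (𝟙 W) hW,
    ← Category.assoc, toTwistOver_comp_ofTwistOver, Category.id_comp,
    appLE_congr_hom _ (homOfLE (le_inf (𝟙 W).le hW)) (𝟙 W ≫ homOfLE (le_inf le_rfl hW)), ← appLE_restrictHom]
  change appLE ((sheafHom (dual E) G).presheaf.map (homOfLE (le_inf le_rfl hW)).op
    (comp c (sheafHom (dual E) G) (trivSection c _ z ((𝟙 W).le.trans hW) (appLE B (𝟙 W) (basisSection f i))) z))
    (𝟙 W) _ = _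
  rw [comp_trivSection_self, presheaf_map_map,
    Subsingleton.elim (homOfLE (le_inf le_rfl hW) ≫ homOfLE (inf_le_left : W ⊓ c.U z ≤ W)) (𝟙 W),
    op_id, (Scheme.Modules.presheaf (sheafHom (dual E) G)).map_id]
  rfl

end Contract

/-! ### The trace with coefficients along `λ_G` -/

section Sandwich

universe w w' w'' v v' v'' u₁ u' u''

variable {C : Type u₁} [Category.{v} C] [Abelian C] {D : Type u'} [Category.{v'} D] [Abelian D]
  {D' : Type u''} [Category.{v''} D'] [Abelian D']
  (Φ : C ⥤ D) (H : C ⥤ D') (H' : D ⥤ D') [Φ.Additive] [H.Additive] [H'.Additive]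
  [Limits.PreservesFiniteLimits Φ] [Limits.PreservesFiniteColimits Φ] [Limits.PreservesFiniteLimits H]
  [Limits.PreservesFiniteColimits H] [Limits.PreservesFiniteLimits H'] [Limits.PreservesFiniteColimits H']
  [HasExt.{w} C] [HasExt.{w'} D] [HasExt.{w''} D']
  [EnoughInjectives C] (γ : ∀ Y : C, H.obj Y ⟶ H'.obj (Φ.obj Y))
  (hγ : ∀ ⦃Y Y' : C⦄ (f : Y ⟶ Y'), H.map f ≫ γ Y' = γ Y ≫ H'.map (Φ.map f))

include hγ in
/-- **Sandwich form with a comparison leg** `l : Φ(F) ⟶ F'` inserted after `Φ(x)`: if `u ≫ γ_E = u'` and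
`γ_F ≫ H'(l) ≫ tr' = tr` then `u' ≫ H'(Φ(x) · l) ≫ tr' = u ≫ H(x) ≫ tr` in `Extⁿ(O, O')`. [folklore] -/
theorem mk₀_comp_mapExactFunctor_comp_mk₀_eq'' {E F : C} {F' : D} {O O' : D'} (u : O ⟶ H.obj E) (l : Φ.obj F ⟶ F')
    (tr' : H'.obj F' ⟶ O') {u' : O ⟶ H'.obj (Φ.obj E)} {tr : H.obj F ⟶ O'} (hu : u ≫ γ E = u')
    (htr : γ F ≫ H'.map l ≫ tr' = tr) {n : ℕ} (x : Ext E F n) :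
    (Ext.mk₀ u').comp ((((x.mapExactFunctor Φ).comp (Ext.mk₀ l) (add_zero n)).mapExactFunctor H').comp (Ext.mk₀ tr')
      (add_zero n)) (zero_add n) =
      (Ext.mk₀ u).comp ((x.mapExactFunctor H).comp (Ext.mk₀ tr) (add_zero n)) (zero_add n) := by
  rw [Ext.mapExactFunctor_comp, Ext.mapExactFunctor_mk₀, Ext.comp_assoc_of_third_deg_zero, Ext.mk₀_comp_mk₀]
  exact mk₀_comp_mapExactFunctor_comp_mk₀_eq' Φ H H' γ hγ u (H'.map l ≫ tr') hu
    (by rw [← Category.assoc] at htr ⊢; exact htr) x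

end Sandwich

section Trace

universe w

variable (E G)

/-- `λ_G` typed on the twist FUNCTOR's object `(- ⊗ M)(𝓗om(E^∨, G))` (definitionally `(𝓗om(E^∨, G))⟨c⟩`), the
source of classes `θ(y) = (- ⊗ M)(y)`; use this spelling when composing `Ext`-classes with `λ_G`. [folklore] -/
abbrev dualHomTwistObj :
    (twistEquivalence X c).functor.obj (sheafHom (dual E) G) ⟶ sheafHom (dual (twist c E)) G :=
  dualHomTwist c E G

variable [HasExt.{w} X.Modules] (hE : IsFiniteLocallyFree E)

/-- **`Tr^{E⟨c⟩}_G(θ(y) · [λ_G]) = Tr^E_G(y)` in `Extⁿ(𝒪_X, G)`** for every `y ∈ Extⁿ(E, 𝓗om(E^∨, G))`, `E`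
finite locally free, `θ = (- ⊗ M)` on `Ext` (`Functor.mapExtAddHom` of th-4's twist functor; `λ_G` is typed on
the functor's object `(- ⊗ M)(𝓗om(E^∨, G)) = (𝓗om(E^∨, G))⟨c⟩`, a definitional equality):
`Tr'(θy · λ) = u' ≫ 𝓗om(E⟨c⟩, θ y) ≫ 𝓗om(E⟨c⟩, λ) ≫ c'`, the comparison `γ = sheafHomTwist` intertwines
`𝓗om(E, y)` with `𝓗om(E⟨c⟩, θ y)` (th-4 #17 `mapExactFunctor_comp_mk₀_eq`), carries the unit to the unit
(#16) and `γ ≫ 𝓗om(E⟨c⟩, λ) ≫ c' = c` (`sheafHomTwist_dualHomTwist_contract`).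
[cite: BuchweitzFlenner2003, §4 (trace map)] -/
theorem traceExtCoeff_twist_comp_dualHomTwist (n : ℕ) (y : Ext.{w} E (sheafHom (dual E) G) n) :
    traceExtCoeff (isFiniteLocallyFree_twist c hE) G n
        (((twistEquivalence X c).functor.mapExtAddHom E (sheafHom (dual E) G) n y).comp
          (Ext.mk₀ (dualHomTwistObj c E G)) (add_zero n)) =
      traceExtCoeff hE G n y := by
  haveI := preservesFiniteColimits_sheafHomFunctor E hE
  haveI := preservesFiniteColimits_sheafHomFunctor (twist c E) (isFiniteLocallyFree_twist c hE)
  rw [Functor.mapExtAddHom_apply, traceExtCoeff_apply, traceExtCoeff_apply]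
  exact mk₀_comp_mapExactFunctor_comp_mk₀_eq'' (twistEquivalence X c).functor (sheafHomFunctor E)
    (sheafHomFunctor (twist c E)) (fun F => sheafHomTwist c E F) (fun _ _ f => sheafHomMap_comp_sheafHomTwist c f)
    (sheafHomUnit E) (dualHomTwistObj c E G) (contract (isFiniteLocallyFree_twist c hE) G)
    (sheafHomUnit_comp_sheafHomTwist c E) (sheafHomTwist_dualHomTwist_contract c E G hE) y

end Trace

end CocycleTwist

end Summit.Ventures.HSemireg

end
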